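import Mathlib
import HarnessLib
import HarnessLib.Audit
import Summits.Parity.Statement
import Literature.Barriers.Parity.PrimePairParity
import Literature.NumberTheory.Sieve.LevelOfDistribution
import Literature.NumberTheory.Sieve.PolymathBoundedGaps

/-!
Route: TargetGraphParity

CLOSED (retired) 2026-08-15T13:50:42Z by operator:999:1257524 — reason: not-a-thesis: assembly does not conclude the sub-problem Statement — note: D-0027 §2.1 audit (human 2026-08-15: routes that do not decide the summit are removed): the assembly concludes `ExactlyBipartite`, not the sub-problem statement; a NEW conforming route may be opened from the same idea (generated `closes : … → _root_.GeneralizedHardyLittlewood`).. The file is kept as the record of this route; refuted decls are indexed as negative knowledge (`ledger negatives`).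

# Route TargetGraphParity — parity obstructs exactly the bipartite target graphs — sign-ghost
criterion (provable) plus odd-cycle disjunctions under GEH (probe)

BARRIER + PROBE ROUTE (declared up front, like route-AnomalousDissipation-TaylorResolutionBarrier):
X does NOT imply
Summit.Parity.GeneralizedHardyLittlewood and is not claimed to; the Assembly concludes in the Target
`ExactlyBipartite`, and the
deliverables are (i) a Theorems file a literature seat can vendor as the T-generalisation of
Literature.Barriers.Parity.PrimePairParity
and (ii) the first ghost-free open disjunction (the pentagon under GEH). Realises cards
bipartite-parity-criterion (spine) and
ghost-lp-duality-hyperedges (addendum). Setting: k linear forms n + h_i (h : Fin k → ℤ injective,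
admissible image) and a TARGET GRAPH
T on Fin k; GraphDHL(T) := for every such tuple, infinitely often SOME EDGE ij of T has n + h_i, n +
h_j both prime (twins = K₂;
Polymath's H₁ ≤ 4 set = the path 0–2–6; H₁ ≤ 6 under GEH = the triangle; DHL[k,2] = K_k). X = X_bar
∧ X_inv ("it suffices to show"):
X_bar (PROVABLE NOW): inside the Polymath 2014 §8 frame a sign-pattern parity ghost — ω(n) =
P(λ(n+h_1),…,λ(n+h_k)), P ≥ 0, killing
every T-target pattern, with balanced one-variable marginals (= no degree-1 Walsh mass = invisible
to the §8 inputs) and positive mass —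
EXISTS IFF T IS 2-COLOURABLE, and every such ω defeats every weight-insertion-invariant deduction of
the T-disjunction
(tree: IsSieveTheoreticDeduction); X_inv (CONJECTURAL, the inverse-parity statement for
disjunctions): under GEH[θ] ∀θ<1 and Polymath's
DHL[3,2], GraphDHL(T) holds for EVERY non-bipartite T — by the route's OddCycleReduction this is
exactly "every odd cycle C_{2r+3} is
GEH-achievable", whose first open case is the pentagon (crux 2) and whose tail is crux 3.
Lean: `(∀ (k : ℕ) (T : SimpleGraph (Fin k)), (∃ P : (Fin k → Bool) → ℝ, (∀ ε, 0 ≤ P ε) ∧ 0 < ∑ ε, P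
ε ∧ (∀ ε, (∃ i j, T.Adj i j ∧ ε i = true ∧ ε j = true) → P ε = 0) ∧ ∀ i, ∑ ε, (if ε i then P ε else
0) = ∑ ε, (if ε i then 0 else P ε)) ↔ T.Colorable 2) ∧ (∀ (k : ℕ) (T : SimpleGraph (Fin k)) (h : Fin
k → ℕ) (P : (Fin k → Bool) → ℝ), (∀ ε, 0 ≤ P ε) → (∀ ε, (∃ i j, T.Adj i j ∧ ε i = true ∧ ε j = true)
→ P ε = 0) → ∀ Inputs : (ℕ → ℝ) → Prop, Inputs (fun n => P (fun i => decide
(Literature.Barriers.Parity.liouvilleR (n + h i) = -1))) → ¬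
Literature.Barriers.Parity.IsSieveTheoreticDeduction Inputs {n : ℕ | ∃ i j, T.Adj i j ∧ (n + h
i).Prime ∧ (n + h j).Prime}) ∧ ((∀ θ : ℝ, θ < 1 →
Literature.NumberTheory.Sieve.GeneralizedElliottHalberstam θ) →
Literature.NumberTheory.Sieve.WeakDicksonHardyLittlewood 3 2 → ∀ (k : ℕ) (T : SimpleGraph (Fin k)),
¬ T.Colorable 2 → ∀ h : Fin k → ℤ, Function.Injective h →
Literature.NumberTheory.Sieve.IsAdmissibleTuple (Finset.univ.image h) → ∃ᶠ n : ℕ in Filter.atTop, ∃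
i j : Fin k, T.Adj i j ∧ (0 < (n : ℤ) + h i ∧ ((n : ℤ) + h i).toNat.Prime) ∧ (0 < (n : ℤ) + h j ∧
((n : ℤ) + h j).toNat.Prime))`

## Assembly
Pure logic plus two finite facts, machine-checked in the planner's Sketch.lean (`assembly_sanity :
Assembly`, rc 0): the first two
conjuncts of ExactlyBipartite ARE BipartiteCriterion and GhostSchema; for the third,
OddCycleReduction reduces a non-bipartite T to the odd
cycles C_{2r+3}: r = 0 is the triangle — cycleGraph 3 = ⊤ (Mathlib cycleGraph_three_eq_top), every
independent set has ≤ 1 vertex, so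
PigeonholeDHL with the hypothesis DHL[3,2] gives it; r = 1 is PentagonGEH (2·1+3 = 5
definitionally); r ≥ 2 is HigherOddCyclesGEH.
BARRIER ROUTE: the conclusion is the Target, not Summit.Parity.GeneralizedHardyLittlewood.

Rationale: WHY THIS LINE. Polymath 8b §8 (arXiv:1407.4897 pp.35–36) kills H₁ = 2 and H₁ ≤ 4 with the hand-made
ghosts 1−λ(n)λ(n+2) and (1−λ(n)λ(n+2))(1−λ(n+2)λ(n+6)),
prints the product ghost over a pair GRAPH in Remark 8.1, and remarks that H₁ ≤ 6 ({0,2,6}, a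
triangle) is not obstructed; the card
turns "which disjunctions of prime-pair problems can sieves settle at ANY level of distribution"
into a linear programme over sign patterns
and solves it: the admissible ghosts are the probability measures on T-independent minus-sets with
all vertex marginals ½, i.e.
(½,…,½) ∈ STAB(T), i.e. (odd-cycle inequalities x(C) ≤ (|C|−1)/2, GrotschelLovaszSchrijver1981) T
bipartite — "parity = no odd cycle",
ghosts = cuts of a bipartition. Imported area: polyhedral combinatorics / 2-colourability (Mathlib
SimpleGraph.two_colorable_iff_forall_loop_even)
applied to Selberg–Bombieri sign ambiguity; the restriction to SIGN patterns is forced, not a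
modelling choice: a twist z^{Ω(n)} with
z ≠ ±1 has mean ≍ x(log x)^{Re z−1}/Γ(z) (Selberg1954; MontgomeryVaughan2007 Thm 7.18 with (7.60)),
a fixed log-power, useless against
log^{−A} inputs, and z = −1 is the unique non-trivial point where 1/Γ(z) = 0 — so "parity" and hence
2-colourability (planner's check:
an order-3 ghost with marginals ⅓ exists combinatorially for the triangle and would absurdly forbid
Polymath's GEH theorem DHL[3,2]).
Calibration already in print: K₃ under GEH and K₅₁-with-α≤2 (DHL[51,3]) under GEH, K₅ under EH
(MaynardAnnals2015, M₅ > 2), K₅₀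
unconditionally (Polymath8b2014 Thm 3.2), and Pintz2015 Thm 3 (two primes in a 6-tuple OR a prime
plus λ(n+r) = −1: a K₇-type sign
target, unconditional) — all non-bipartite, while "λ(p+d) = −1 for one given d", twins, paths, stars
and even cycles are bipartite and
blocked. What no prior route does: the four GHL routes (DicksonFibration, MobiusShiftedPrimes,
QuadraticRoots, TauberianTwins) attack the
single edge; this route maps exactly which multi-target WEAKENINGS of the binary slice are
sieve-accessible (negative knowledge for every
planner: reject bipartite disjunctions as sieve cruxes) and staffs the sharp test of "parity is the
only obstruction": the pentagon, where
no ghost exists but single-prime marginals (Maynard ICM 2018 §6, arXiv:1910.13450 p.9: "cannot hope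
to prove k/2 … simultaneously prime";
"no general barriers beyond the parity phenomenon") are a factor 2 short.

RANKED CRUXES. #0 ExactlyBipartite (target) — X = X_bar ∧ X_inv of § Thesis, written out: (ghost
criterion: sign ghost ↔ 2-colourable, all k, T) ∧ (weight-insertion schema for every T, h, P) ∧
(GEH[θ] ∀θ<1 → DHL[3,2] → every non-2-colourable T has GraphDHL for all injective admissible
tuples). (why it might fail: Barrier half = finite combinatorics + the tree's weight-insertion
schema (safe); inverse half inherits PentagonGEH/HigherOddCyclesGEH and carries DHL[3,2] (Polymath
8b Thm 3.2(xii); not in tree) as hypothesis; fails iff some odd cycle is GEH-unreachable by every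
method — a barrier beyond parity.) [Polymath8b2014, arXiv:1407.4897, arXiv:1910.13450,
MaynardAnnals2015, Pintz2015]
#2 PentagonGEH (crux) — (card Crux 1, OddCycleAchievability, first open case) GEH[θ] for all θ < 1
implies: for every injective h : Fin 5 → ℤ with admissible image, infinitely many n have n + h_i and
n + h_j both prime for some EDGE ij of the 5-cycle (cycleGraph 5: j = i ± 1 mod 5). Ghost-free by
BipartiteCriterion (the rotation-symmetric LP a + 3b + c = 0 forces P ≡ 0); not derivable from
DHL[3,2] (the realised pairs may form the pentagram) nor from DHL[5,2] (diagonals); DHL[5,3] would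
suffice (α(C₅) = 2) but is beyond the functional ceiling. [difficulty: open-problem] (why it might
fail: Single-prime marginals cannot see adjacency: a linear certificate needs Σπ_i > 2 on the
5-tuple (DHL[5,3] threshold) but GEH Selberg-square weights give Σπ_i ≤ ½·M_{5,ε} ≤ ⅝·log 9 < 1.38
(tree ceiling); if all GEH-computable certificates obey such a ceiling, C₅ is ghost-free yet
unreachable.) [Polymath8b2014, arXiv:1407.4897, arXiv:1910.13450, MaynardAnnals2015,
Literature.Barriers.Parity.MaynardFunctionalCeiling,
Literature.Barriers.Parity.Polymath2014_epsFunctional_le]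
#3 HigherOddCyclesGEH (crux) — GEH[θ] for all θ < 1 implies GraphDHL(C_{2r+3}) for every r ≥ 2 (odd
cycles of length ≥ 7) and every injective admissible (2r+3)-tuple: infinitely often two CYCLICALLY
ADJACENT forms are simultaneously prime. With PentagonGEH and Polymath's DHL[3,2] this is, by
OddCycleReduction, the full inverse-parity statement for disjunctions (every non-bipartite target
graph is GEH-achievable); odd cycles are pairwise incomparable under injective tuples, so the family
is filed whole, C₇ being the natural first split. [deps: PentagonGEH] [difficulty: open-problem]
(why it might fail: Adjacency on C_{2r+3} via marginals needs r+2 of 2r+3 forms prime (average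
marginal → ½ = the per-coordinate parity ceiling) while Selberg-square weights give ≈(θ/2k)·log k
per form (Maynard ICM §6); a k-uniform marginal ceiling < ½ kills the sieve route for all large r;
may be HL-hard.) [arXiv:1910.13450, Polymath8b2014, MaynardAnnals2015,
Literature.Barriers.Parity.MaynardFunctionalCeiling]
#9 BipartiteCriterion (support) — (card Crux 2, the finite theorem) for every k and T : SimpleGraph
(Fin k): there is P : (Fin k → Bool) → ℝ, P ≥ 0, of positive total mass, vanishing on every pattern
whose true-set contains an edge of T, with balanced marginals (mass of {ε i = true} = mass of {ε i =
false} for every i) IFF T is 2-colourable. ⇐: P = 1[ε = σ] + 1[ε = ¬σ] for a 2-colouring σ (colour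
classes are independent; marginals 1 = 1). ⇒: an odd closed walk w₀…w_L = w₀ (Mathlib
two_colorable_iff_forall_loop_even) meets every independent true-set in ≤ (L−1)/2 of its L cyclic
positions, but by balanced marginals the expected number of true positions is L/2 — linearity of
expectation. Refuter-checked ✓ (triage 2026-08-15). [difficulty: M] [arXiv:1407.4897,
GrotschelLovaszSchrijver1981, Mathlib SimpleGraph.two_colorable_iff_forall_loop_even]
#9 GhostSchema (support) — (card Crux 3, generalises PrimePairParity_holds from edge/path to every
T) for every k, T, natural shifts h : Fin k → ℕ and P ≥ 0 vanishing on patterns whose true-set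
contains a T-edge, the weight ω(n) = P(i ↦ [λ(n + h_i) = −1]) satisfies: for every input class
Inputs, Inputs ω → ¬ IsSieveTheoreticDeduction Inputs {n : some T-edge ij has n+h_i, n+h_j prime} —
because λ = −1 at primes makes ω vanish on the target set, so every weighted detection sum is 0
(proof = PrimePairParity_holds verbatim with liouvilleR_prime). [difficulty: provable-now]
[Literature.Barriers.Parity.PrimePairParity, arXiv:1407.4897]
#9 OddCycleReduction (support) — if GraphDHL(C_{2r+3}) holds for every r (all odd cycles, injective
admissible tuples), then GraphDHL(T) holds for every non-2-colourable T on Fin k. Proof: a shortest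
odd closed walk of T is an odd CYCLE, i.e. an injective homomorphism φ : cycleGraph (2r+3) → T; for
an injective admissible h, h ∘ φ is injective with admissible image (sub-tuples of admissible tuples
are admissible: tupleResidueCount is monotone), and a prime edge of the cycle maps to a prime edge
of T. (Mathlib TODO 'IsBipartite ↔ no odd cycle' is the graph half.) [difficulty: M] [Mathlib
SimpleGraph.two_colorable_iff_forall_loop_even, Literature.NumberTheory.Sieve.IsAdmissibleTuple]
#9 PigeonholeDHL (support) — (calibration glue) if every T-independent set has ≤ m vertices (α(T) ≤
m) then DHL[k, m+1] (tree WeakDicksonHardyLittlewood k (m+1)) implies GraphDHL(T): m+1 primes among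
the k forms of an injective tuple occupy a non-independent index set. Instances: K₅₀ unconditionally
(weakDHL_fifty_two), K₅ under EH (M₅ > 2), K₃ and every T on 51 vertices with α ≤ 2 under GEH
(Polymath 8b Thm 3.2 (xii),(xiii)); used in the Assembly for the triangle (cycleGraph 3 = ⊤, α = 1).
[difficulty: provable-now] [Polymath8b2014,
Literature.NumberTheory.Sieve.WeakDicksonHardyLittlewood,
Literature.NumberTheory.Sieve.weakDHL_fifty_two]
#9 ManyPrimesThreshold (support) — (addendum card ghost-lp-duality-hyperedges item 1, symmetric
case) for the target "at least m of the k forms prime" a sign ghost (P ≥ 0, positive mass, vanishing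
on patterns with ≥ m trues, balanced marginals) exists IFF k + 2 ≤ 2m: ⇒ E|M| = k/2 ≤ m − 1; ⇐ M
uniform of size k/2 (k even) or sizes (k∓1)/2 mixed half-half (k odd). Makes Maynard's "cannot hope
to prove k/2 of the forms prime by a sieve" (arXiv:1910.13450 §6) exact: m = 2 is blocked iff k ≤ 2
(K₃ under GEH is sharp), m = 3 iff k ≤ 4 (so DHL[5,3] is ghost-free — the foreseen split of
PentagonGEH). [difficulty: provable-now] [arXiv:1910.13450, arXiv:1407.4897]

TWO-LAYER PLAN. PentagonGEH ⇐ ThreeOfFiveGEH → PentagonGEH, where ThreeOfFiveGEH := (∀θ<1, GEH θ) →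
WeakDicksonHardyLittlewood 5 3 (addendum crux 3;
ghost-free by ManyPrimesThreshold since 5 + 2 > 6; glue = PigeonholeDHL with α(C₅) = 2) — ONE
sufficient child, blocked for Selberg-square
weights by the functional ceiling (needs Σπ_i > 2, i.e. a ratio > 4 > M_{5,ε} ≤ 2.75), so a prover
must bring a non-Selberg positivity
certificate (Bombieri asymptotic-sieve cells under GEH, vector-sieve cross terms,
higher-Walsh-degree certificates with GEH-computable
expectations); the alternative child is a genuinely pair-sensitive certificate for adjacency (not
typable yet). HigherOddCyclesGEH ⇐
C₇ ∧ (r ≥ 3). BipartiteCriterion ⇐ (⇒ half: odd closed walk + expectation) ∧ (⇐ half: cut ghost) if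
a prover wants halves. Nothing filed now.

KILL CRITERIA. (1) A refuter exhibits an ADMISSIBLE ghost for a non-bipartite T from outside the
sign-pattern class (non-negative, kills all C₅- or K₃-edges,
non-constant components with log^{−A} cancellation in progressions to level x^{1−ε}): the frame of
X_bar is wrong → restate the ghost class
(route edit --restate BipartiteCriterion/GhostSchema) or close refuted; order-3 Ω-twists were
checked and are inadmissible (§ Cheapest falsifier).
(2) A theorem that every GEH-computable positivity certificate on 5-tuples has adjacency functional
below threshold (a multi-coordinate
'adjacency ceiling' à la Polymath Cor. 6.4): PentagonGEH is sieve-unreachable → pivot: file that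
ceiling as the route's ¬-side statement —
the route then records a NEW barrier strictly beyond parity (equally valuable) and X_inv is dropped
from the Target by --restate.
(3) PentagonGEH proved → expand HigherOddCyclesGEH (C₇ first). (4) DHL[2,2] (prime pairs, existence
form) proved by any means moots X_inv
(everything achievable) but not X_bar. Formal refutation of PentagonGEH/HigherOddCyclesGEH
themselves would contradict Hardy–Littlewood and
is not expected; these cruxes close by proof or stall, and the census of WHY they stall is the
route's scientific output.

NOT DECOMPOSED YET. Affine forms a_i n + b_i (stars 'p and kp+2', Dickson systems) — same LP,
heavier Lean; hypergraph targets beyond the complete uniform one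
and the Farkas dual = GPY functional (addendum items 1–2); the Eulerian-subgraph identity
E∏_{ij∈T}(1−ε_iε_j) = 2^{c(T)}·[T bipartite]
for the canonical product ghost; Pintz-type mixed prime/sign targets; EH-only versions (under EH
even the triangle is open: Polymath could
not improve Maynard's H₁ ≤ 12, arXiv:1407.4897 p.3); the quantitative achievability level θ*(T); the
Literature cite fact 'GEH ⇒ DHL[3,2]'
(Polymath 8b Thm 3.2(xii)) that would discharge the DHL[3,2] hypothesis of X_inv — requested, not a
route item.

CHEAPEST FALSIFIER. The finite LPs: C₅ (5 sign variables; rotation symmetry a + 3b + c = 0 forces P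
≡ 0 — card author) and K₃ (3 variables — card author);
both agree with BipartiteCriterion. Planner's frame check (done by hand this session): is the
SIGN-pattern class the right ghost class? An
order-3 twist g = z^{Ω}, z = e^{2πi/3} (g(p) = z at primes) admits a combinatorial ghost for the
TRIANGLE (choose the z-coordinate
uniformly, the other two uniform on {1, z²}: all marginals ⅓, kills 'two of three prime'), which
would 'prohibit' Polymath's GEH theorem
DHL[3,2] — contradiction — UNLESS its inputs fail; they do: Σ_{n≤x} z^{Ω(n)} = (F(1,z)/Γ(z)) x (log
x)^{z−1} + O(x(log x)^{Re z−2})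
(MontgomeryVaughan2007 Thm 7.18 + (7.60); Selberg1954) is a genuine (log x)^{−3/2} term, not
log^{−A}; only z = −1 has 1/Γ(z) = 0. So
the frame survives its cheapest attack and the criterion is exactly about parity. Next cheapest
(kit; not run — hub compute-free this
session): maximise Σ_i π_i over Polymath's GEH class M_{5,ε} (ε < 1/4) on {0,2,6,8,12}: expected ≈
1.0–1.4 against the 2 needed for C₅ via
marginals — quantifies crux 2's gap before anyone proves anything.

NUMBERS. M₅ > 2 (MaynardAnnals2015; tree
Literature.NumberTheory.Sieve.exists_two_lt_maynardFunctional_five_holds) ⇒ DHL[5,2] under EH (K₅);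
M_k ≤ (k/(k−1)) log k (Polymath 8b Cor. 6.4; tree maynardFunctional_le_holds): M₅ ≤ 2.012; M_{k,ε} ≤
(k/(k−1)) log(2k−1) (Prop. 6.5; tree
Literature.Barriers.Parity.Polymath2014_epsFunctional_le, proved): M_{5,ε} ≤ 2.747 < 4 = 2m/θ for
three primes among five at θ = 1, so
Σ_i π_i = (θ/2)·M ≤ 1.38 < 2; DHL[3,2] and DHL[51,3] under GEH, DHL[54,3] under EH, DHL[50,2]
unconditionally (arXiv:1407.4897 Thm 3.2,
p.8); H(5) = 12 via {0,2,6,8,12}; per-coordinate parity ceiling π_i ≤ ½ (+o(1));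
ManyPrimesThreshold: m of k ghost-blocked iff k + 2 ≤ 2m;
Pintz2015 Thm 3: k = 6, unconditional (GPY + Bombieri–Vinogradov).

DEFINITION REQUESTS. After open (ledger workitem add --kind definition, topic
Summits/Parity/GeneralizedHardyLittlewood/Theorems): `GraphDHL (T : SimpleGraph (Fin k)) : Prop`
(the inlined '∀ injective admissible h, ∃ᶠ n, ∃ edge both prime'), `HasSignGhost (T : SimpleGraph
(Fin k)) : Prop` (the inlined LP feasibility),
`signPatternWeight (P) (h : Fin k → ℕ) : ℕ → ℝ` and `edgePrimeSet T h : Set ℕ` (for Theorems files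
extending PrimePairParity). Cite fact wanted
(kind cite, family parity): "GEH[θ] ∀θ<1 ⇒ DHL[3,2]" (Polymath8b2014 Thm 3.2(xii) via Thms
3.14–3.15) — discharges the DHL[3,2] hypothesis of X_inv.

Novelty: Searches (2026-08-15): lit search --hybrid "parity problem sieve disjunction prime pairs target
graph bipartite odd cycle Liouville weight"
(12 local docs, graph-theory/NT textbooks, none on multi-target parity); lit search --source
crossref "parity barrier sieve bounded gaps primes"
(15: Zhang 2014, Broughan 2021 CUP chapters, Ramaré — no target-family classification); --source
zbmath "parity problem sieve prime pairs"
(2, irrelevant); OpenAlex / Semantic Scholar / arXiv: HTTP 429 this session; lit galaxy search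
--star all and --star pdf: galaxyd queued > 90 s
twice (saturated) — recorded as not consulted; lit frontier Parity --since 2020 (30 rows, none on
disjunctions/ghost classification); lit
bridges Parity --cross any (generic); READ: arXiv:1407.4897 pp.3, 8, 35–36 (Thm 1.4, Thm 3.2, §8,
Remark 8.1), arXiv:1910.13450 §6 p.9,
Pintz2015 = arXiv:1004.1065 Thms 1–6, MontgomeryVaughan2007 Thm 7.18–7.19 (PDF p.177–179); the two
cards and both refuter audits
(card graded new-combination by refuter-triage-3, addendum graded variant by
refuter-novelty-audit-13, 2026-08-15).
Nearest prior art found: arXiv:1407.4897 Remark 8.1 (product ghost over the edge set of a pair graph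
— the ⇐ direction, for a graph that is
bipartite by residues mod 3) and §8 (edge, path); arXiv:1910.13450 §6 (the informal 'k/2' ceiling
and 'no general barriers beyond parity');
Pintz2015 (the disjunction phenomenon: some d ≤ 16 works, no single given d even under EH); tree
Literature.Barriers.Parity.PrimePair  [refs: 1407.4897, 1910.13450, 1004.1065, Pintz2015, MontgomeryVaughan2007]

Barriers (technique_class: parity-ghost-classification sieve-target-graphs): - technique_class: parity-ghost-classification sieve-target-graphs
- Literature.Barriers.Parity.PrimePairParity: not evaded — this route IS its generalisation (same
frame: IsSieveTheoreticDeduction, λ-sign ghosts, Möbius-randomness inputs left as hypotheses `Inputs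
ω` exactly as the tree leaves Polymath2014_liouvillePairAP open); GhostSchema extends
weightedDetectionSum_twin/_gapFour to every T and BipartiteCriterion says precisely where such
ghosts exist.
- Literature.Barriers.Parity.SelbergParityBarrier: one-sequence (k = 1) statement; consistent shadow
(a single form is the graph with one vertex and a loop-free target — no edge; a single edge is
bipartite and blocked); nothing to evade.
- Literature.Barriers.Parity.MaynardFunctionalCeiling: RESPECTED and load-bearing for the cruxes'
why-might-fail: M_k ≤ (k/(k−1)) log k and Polymath2014_epsFunctional_le cap single-prime marginals,
so PentagonGEH/HigherOddCyclesGEH ask for certificates OUTSIDE the class the ceiling governs; the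
route does not claim to beat it with Selberg squares.
- Literature.Barriers.Parity.CriticalDensityHalf: the density-½ model is the k = 2 shadow of
'marginals ½ on an independent set'; consistent (explains why cliques on ≥ 3 forms escape while
every 2-colourable family does not).
- Literature.Barriers.Parity.TrueComplexityBinary: the analytic reason degree ≥ 2 sign monomials are
invisible; consistent, not evaded.
- Literature.Barriers.Parity.WeightedSieveLimit / Literature.Barriers.Parity.LinearSieveO

Novelty grade: new-combination — ROUTE REVIEW (refuter 2026-08-15; full = REVIEW-TargetGraphParity.md on stmt-Parity-4342). VERDICT keep as DECLARED barrier+probe route. N1: Assembly concludes ExactlyBipartite, NOT the summit (by design); route can never close the sub-problem; deliverables = X_bar (provable now) + census of why pro (refuter refuter-rreview-route-AtomisticToContinu-771e1018-0, 2026-08-15T13:38:37Z; prior: arXiv:1407.4897, arXiv:1910.13450, Pintz2015, GrotschelLovaszSchrijver1981, MontgomeryVaughan2007, Literature.Barriers.Parity.PrimePairParity)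

History (route lifecycle, newest last):
- 2026-08-15T13:50:42Z · CLOSED retired — not-a-thesis: assembly does not conclude the sub-problem Statement (operator:999:1257524)

sub-problem: GeneralizedHardyLittlewood · status: closed(retired) · opened planner-plancard-Parity-GeneralizedHardyLittl-17218a8b-0 2026-08-15T11:32:46Z · rev 0 · ledger route-Parity-TargetGraphParity
GENERATED by the gate from the ledger (D-0016/17). Provers cite these decls: `theorem foo : Summit.Parity.GeneralizedHardyLittlewood.Theses.TargetGraphParity.<Decl> := …` in Summits/Parity/GeneralizedHardyLittlewood/Theorems/<Name>.lean.
-/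

namespace Summit.Parity.GeneralizedHardyLittlewood.Theses.TargetGraphParity

open scoped BigOperators Topology Manifold Classical MeasureTheory ProbabilityTheory Matrix InnerProductSpace ComplexConjugate ContinuousMap
open Filter Set Function TopologicalSpace MeasureTheory

attribute [summit_statement] _root_.GeneralizedHardyLittlewood

/-- item stmt-Parity-4342 · target · rank 0 · closed · moot by None · by planner
why it might fail: Barrier half = finite combinatorics + the tree's weight-insertion schema (safe); inverse half inherits PentagonGEH/HigherOddCyclesGEH and carries DHL[3,2] (Polymath 8b Thm 3.2(xii); not in tree) as hypothesis; fails iff some odd cycle is GEH-unreachable by every method — a barrier beyond parity.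
sources: Polymath8b2014, arXiv:1407.4897, arXiv:1910.13450, MaynardAnnals2015, Pintz2015
[target] X = X_bar ∧ X_inv of § Thesis, written out: (ghost criterion: sign ghost ↔ 2-colourable,
all k, T) ∧ (weight-insertion schema for every T, h, P) ∧ (GEH[θ] ∀θ<1 → DHL[3,2] → every
non-2-colourable T has GraphDHL for all injective admissible tuples). -/
@[route_item "route-Parity-TargetGraphParity"]
def ExactlyBipartite : Prop :=
  (∀ (k : ℕ) (T : SimpleGraph (Fin k)), (∃ P : (Fin k → Bool) → ℝ, (∀ ε, 0 ≤ P ε) ∧ 0 < ∑ ε, P ε ∧ (∀ ε, (∃ i j, T.Adj i j ∧ ε i = true ∧ ε j = true) → P ε = 0) ∧ ∀ i, ∑ ε, (if ε i then P ε else 0) = ∑ ε, (if ε i then 0 else P ε)) ↔ T.Colorable 2) ∧ (∀ (k : ℕ) (T : SimpleGraph (Fin k)) (h : Fin k → ℕ) (P : (Fin k → Bool) → ℝ), (∀ ε, 0 ≤ P ε) → (∀ ε, (∃ i j, T.Adj i j ∧ ε i = true ∧ ε j = true) → P ε = 0) → ∀ Inputs : (ℕ → ℝ) → Prop, Inputs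 (fun n => P (fun i => decide (((ArithmeticFunction.liouville (n + h i) : ℤ) : ℝ) = -1))) → ¬ (∀ ω : ℕ → ℝ, (∀ n, 0 ≤ ω n) → Inputs ω → ∃ x : ℕ, ∃ ν : ℕ → ℝ, (∀ n, 0 ≤ ν n) ∧ 0 < ∑ n ∈ Finset.Icc x (2 * x), ν n * Set.indicator {n : ℕ | ∃ i j, T.Adj i j ∧ (n + h i).Prime ∧ (n + h j).Prime} 1 n * ω n)) ∧ ((∀ θ : ℝ, θ < 1 → ∀ ε : ℝ, 0 < ε → ∀ A : ℝ, 0 < A → ∀ k : ℕ, ∀ K : ℝ, 1 ≤ K → ∀ N M : ℝ → ℝ, ∀ α β : ℝ → ArithmeticFunction ℝ, (∀ᶠ x in Filter.atTop, x ^ ε ≤ N x ∧ N x ≤ x ^ (1 - ε) ∧ x ^ ε ≤ M x ∧ M x ≤ x ^ (1 - ε)) → (∃ C : ℝ, 1 ≤ C ∧ ∀ᶠ x in Filter.atTop, x / C ≤ N x * M x ∧ N x * M x ≤ C * x) → (∀ x, ∀ n : ℕ, (n : ℝ) < N x ∨ K * N x < n → α x n = 0) → (∀ x, ∀ n : ℕ,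 (n : ℝ) < M x ∨ K * M x < n → β x n = 0) → (∀ᶠ x in Filter.atTop, ∀ n : ℕ, |α x n| ≤ ((ArithmeticFunction.sigma 0 n : ℕ) : ℝ) ^ k * Real.log x ^ k ∧ |β x n| ≤ ((ArithmeticFunction.sigma 0 n : ℕ) : ℝ) ^ k * Real.log x ^ k) → (∀ B : ℝ, 0 < B → ∃ C : ℝ, ∀ᶠ x in Filter.atTop, ∀ q r : ℕ, 1 ≤ q → 1 ≤ r → ∀ a : (ZMod q)ˣ, |(∑ n ∈ (Finset.Icc 1 ⌊K * M x⌋₊).filter (fun n : ℕ => (n : ZMod q) = (a : ZMod q)), (if n.Coprime r then β x n else 0)) - (∑ n ∈ (Finset.Icc 1 ⌊K * M x⌋₊).filter (fun n : ℕ => n.Coprime q), (if n.Coprime r then β x n else 0)) / Nat.totient q| ≤ C * ((ArithmeticFunction.sigma 0 (q * r) : ℕ) : ℝ) ^ k * M x / Real.log x ^ B) → (fun x : ℝ => ∑ q ∈ Finset.Icc 1 ⌊x ^ θ⌋₊, ⨆ a : (ZMod q)ˣ, |(∑ n ∈ (Finset.Icc 1 ⌊K * K * (N x * M x)⌋₊).filter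 (fun n : ℕ => (n : ZMod q) = (a : ZMod q)), (α x * β x) n) - (∑ n ∈ (Finset.Icc 1 ⌊K * K * (N x * M x)⌋₊).filter (fun n : ℕ => n.Coprime q), (α x * β x) n) / Nat.totient q|) =O[Filter.atTop] fun x : ℝ => x / Real.log x ^ A) → (∀ H : Finset ℤ, Literature.NumberTheory.Sieve.IsAdmissibleTuple H → H.card = 3 → ∃ᶠ n : ℕ in Filter.atTop, 2 ≤ (H.filter fun h => 0 < (n : ℤ) + h ∧ ((n : ℤ) + h).toNat.Prime).card) → ∀ (k : ℕ) (T : SimpleGraph (Fin k)), ¬ T.Colorable 2 → ∀ h : Fin k → ℤ, Function.Injective h → Literature.NumberTheory.Sieve.IsAdmissibleTuple (Finset.univ.image h) → ∃ᶠ n : ℕ in Filter.atTop, ∃ i j : Fin k, T.Adj i j ∧ (0 < (n : ℤ) + h i ∧ ((n : ℤ) + h i).toNat.Prime) ∧ (0 < (n : ℤ) + h j ∧ ((n : ℤ) + h j).toNat.Prime))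

/-- item stmt-Parity-4343 · crux · rank 2 · closed · moot by None · by planner
why it might fail: Single-prime marginals cannot see adjacency: a linear certificate needs Σπ_i > 2 on the 5-tuple (DHL[5,3] threshold) but GEH Selberg-square weights give Σπ_i ≤ ½·M_{5,ε} ≤ ⅝·log 9 < 1.38 (tree ceiling); if all GEH-computable certificates obey such a ceiling, C₅ is ghost-free yet unreachable.
sources: Polymath8b2014, arXiv:1407.4897, arXiv:1910.13450, MaynardAnnals2015, Literature.Barriers.Parity.MaynardFunctionalCeiling, Literature.Barriers.Parity.Polymath2014_epsFunctional_le
[crux] (card Crux 1, OddCycleAchievability, first open case) GEH[θ] for all θ < 1 implies: for every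
injective h : Fin 5 → ℤ with admissible image, infinitely many n have n + h_i and n + h_j both prime
for some EDGE ij of the 5-cycle (cycleGraph 5: j = i ± 1 mod 5). Ghost-free by BipartiteCriterion
(the rotation-symmetric LP a + 3b + c = 0 forces P ≡ 0); not derivable from DHL[3,2] (the realised
pairs may form the pentagram) nor from DHL[5,2] (diagonals); DHL[5,3] would suffice (α(C₅) = 2) but
is beyond the functional ceiling. [difficulty: open-problem] -/
@[route_item "route-Parity-TargetGraphParity"]
def PentagonGEH : Prop :=
  (∀ θ : ℝ, θ < 1 → ∀ ε : ℝ, 0 < ε → ∀ A : ℝ, 0 < A → ∀ k : ℕ, ∀ K : ℝ, 1 ≤ K → ∀ N M : ℝ → ℝ, ∀ α β : ℝ → ArithmeticFunction ℝ, (∀ᶠ x in Filter.atTop, x ^ ε ≤ N x ∧ N x ≤ x ^ (1 - ε) ∧ x ^ ε ≤ M x ∧ M x ≤ x ^ (1 - ε)) → (∃ C : ℝ, 1 ≤ C ∧ ∀ᶠ x in Filter.atTop, x / C ≤ N x * M x ∧ N x * M x ≤ C * x) → (∀ x, ∀ n : ℕ, (n : ℝ) < N x ∨ K * N x < n → α x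 n = 0) → (∀ x, ∀ n : ℕ, (n : ℝ) < M x ∨ K * M x < n → β x n = 0) → (∀ᶠ x in Filter.atTop, ∀ n : ℕ, |α x n| ≤ ((ArithmeticFunction.sigma 0 n : ℕ) : ℝ) ^ k * Real.log x ^ k ∧ |β x n| ≤ ((ArithmeticFunction.sigma 0 n : ℕ) : ℝ) ^ k * Real.log x ^ k) → (∀ B : ℝ, 0 < B → ∃ C : ℝ, ∀ᶠ x in Filter.atTop, ∀ q r : ℕ, 1 ≤ q → 1 ≤ r → ∀ a : (ZMod q)ˣ, |(∑ n ∈ (Finset.Icc 1 ⌊K * M x⌋₊).filter (fun n : ℕ => (n : ZMod q) = (a : ZMod q)), (if n.Coprime r then β x n else 0)) - (∑ n ∈ (Finset.Icc 1 ⌊K * M x⌋₊).filter (fun n : ℕ => n.Coprime q), (if n.Coprime r then β x n else 0)) / Nat.totient q| ≤ C * ((ArithmeticFunction.sigma 0 (q * r) : ℕ) : ℝ) ^ k * M x / Real.log x ^ B) → (fun x : ℝ => ∑ q ∈ Finset.Icc 1 ⌊x ^ θ⌋₊, ⨆ a : (ZMod q)ˣ, |(∑ n ∈ (Finset.Icc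 1 ⌊K * K * (N x * M x)⌋₊).filter (fun n : ℕ => (n : ZMod q) = (a : ZMod q)), (α x * β x) n) - (∑ n ∈ (Finset.Icc 1 ⌊K * K * (N x * M x)⌋₊).filter (fun n : ℕ => n.Coprime q), (α x * β x) n) / Nat.totient q|) =O[Filter.atTop] fun x : ℝ => x / Real.log x ^ A) → ∀ h : Fin 5 → ℤ, Function.Injective h → Literature.NumberTheory.Sieve.IsAdmissibleTuple (Finset.univ.image h) → ∃ᶠ n : ℕ in Filter.atTop, ∃ i j : Fin 5, (SimpleGraph.cycleGraph 5).Adj i j ∧ (0 < (n : ℤ) + h i ∧ ((n : ℤ) + h i).toNat.Prime) ∧ (0 < (n : ℤ) + h j ∧ ((n : ℤ) + h j).toNat.Prime)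

/-- item stmt-Parity-4344 · crux · rank 3 · closed · moot by None · by planner
why it might fail: Adjacency on C_{2r+3} via marginals needs r+2 of 2r+3 forms prime (average marginal → ½ = the per-coordinate parity ceiling) while Selberg-square weights give ≈(θ/2k)·log k per form (Maynard ICM §6); a k-uniform marginal ceiling < ½ kills the sieve route for all large r; may be HL-hard.
sources: arXiv:1910.13450, Polymath8b2014, MaynardAnnals2015, Literature.Barriers.Parity.MaynardFunctionalCeiling
[crux] GEH[θ] for all θ < 1 implies GraphDHL(C_{2r+3}) for every r ≥ 2 (odd cycles of length ≥ 7)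
and every injective admissible (2r+3)-tuple: infinitely often two CYCLICALLY ADJACENT forms are
simultaneously prime. With PentagonGEH and Polymath's DHL[3,2] this is, by OddCycleReduction, the
full inverse-parity statement for disjunctions (every non-bipartite target graph is GEH-achievable);
odd cycles are pairwise incomparable under injective tuples, so the family is filed whole, C₇ being
the natural first split. [deps: PentagonGEH] [difficulty: open-problem] -/
@[route_item "route-Parity-TargetGraphParity"]
def HigherOddCyclesGEH : Prop :=
  (∀ θ : ℝ, θ < 1 → ∀ ε : ℝ, 0 < ε → ∀ A : ℝ, 0 < A → ∀ k : ℕ, ∀ K : ℝ, 1 ≤ K → ∀ N M : ℝ → ℝ, ∀ α β : ℝ → ArithmeticFunction ℝ, (∀ᶠ x in Filter.atTop, x ^ ε ≤ N x ∧ N x ≤ x ^ (1 - ε) ∧ x ^ ε ≤ M x ∧ M x ≤ x ^ (1 - ε)) → (∃ C : ℝ, 1 ≤ C ∧ ∀ᶠ x in Filter.atTop, x / C ≤ N x * M x ∧ N x * M x ≤ C * x) → (∀ x, ∀ n : ℕ, (n : ℝ) < N x ∨ K * N x < n → α x n = 0) → (∀ x, ∀ n : ℕ, (n : ℝ) < M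 x ∨ K * M x < n → β x n = 0) → (∀ᶠ x in Filter.atTop, ∀ n : ℕ, |α x n| ≤ ((ArithmeticFunction.sigma 0 n : ℕ) : ℝ) ^ k * Real.log x ^ k ∧ |β x n| ≤ ((ArithmeticFunction.sigma 0 n : ℕ) : ℝ) ^ k * Real.log x ^ k) → (∀ B : ℝ, 0 < B → ∃ C : ℝ, ∀ᶠ x in Filter.atTop, ∀ q r : ℕ, 1 ≤ q → 1 ≤ r → ∀ a : (ZMod q)ˣ, |(∑ n ∈ (Finset.Icc 1 ⌊K * M x⌋₊).filter (fun n : ℕ => (n : ZMod q) = (a : ZMod q)), (if n.Coprime r then β x n else 0)) - (∑ n ∈ (Finset.Icc 1 ⌊K * M x⌋₊).filter (fun n : ℕ => n.Coprime q), (if n.Coprime r then β x n else 0)) / Nat.totient q| ≤ C * ((ArithmeticFunction.sigma 0 (q * r) : ℕ) : ℝ) ^ k * M x / Real.log x ^ B) → (fun x : ℝ => ∑ q ∈ Finset.Icc 1 ⌊x ^ θ⌋₊, ⨆ a : (ZMod q)ˣ, |(∑ n ∈ (Finset.Icc 1 ⌊K * K * (N x * M x)⌋₊).filter (fun n : ℕ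 => (n : ZMod q) = (a : ZMod q)), (α x * β x) n) - (∑ n ∈ (Finset.Icc 1 ⌊K * K * (N x * M x)⌋₊).filter (fun n : ℕ => n.Coprime q), (α x * β x) n) / Nat.totient q|) =O[Filter.atTop] fun x : ℝ => x / Real.log x ^ A) → ∀ r : ℕ, 2 ≤ r → ∀ h : Fin (2 * r + 3) → ℤ, Function.Injective h → Literature.NumberTheory.Sieve.IsAdmissibleTuple (Finset.univ.image h) → ∃ᶠ n : ℕ in Filter.atTop, ∃ i j : Fin (2 * r + 3), (SimpleGraph.cycleGraph (2 * r + 3)).Adj i j ∧ (0 < (n : ℤ) + h i ∧ ((n : ℤ) + h i).toNat.Prime) ∧ (0 < (n : ℤ) + h j ∧ ((n : ℤ) + h j).toNat.Prime)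

/-- item stmt-Parity-4345 · support · rank 9 · closed · moot by None · by planner
sources: arXiv:1407.4897, GrotschelLovaszSchrijver1981, Mathlib SimpleGraph.two_colorable_iff_forall_loop_even
[support] (card Crux 2, the finite theorem) for every k and T : SimpleGraph (Fin k): there is P :
(Fin k → Bool) → ℝ, P ≥ 0, of positive total mass, vanishing on every pattern whose true-set
contains an edge of T, with balanced marginals (mass of {ε i = true} = mass of {ε i = false} for
every i) IFF T is 2-colourable. ⇐: P = 1[ε = σ] + 1[ε = ¬σ] for a 2-colouring σ (colour classes are
independent; marginals 1 = 1). ⇒: an odd closed walk w₀…w_L = w₀ (Mathlib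
two_colorable_iff_forall_loop_even) meets every independent true-set in ≤ (L−1)/2 of its L cyclic
positions, but by balanced marginals the expected number of true positions is L/2 — linearity of
expectation. Refuter-checked ✓ (triage 2026-08-15). [difficulty: M] -/
@[route_item "route-Parity-TargetGraphParity"]
def BipartiteCriterion : Prop :=
  ∀ (k : ℕ) (T : SimpleGraph (Fin k)), (∃ P : (Fin k → Bool) → ℝ, (∀ ε, 0 ≤ P ε) ∧ 0 < ∑ ε, P ε ∧ (∀ ε, (∃ i j, T.Adj i j ∧ ε i = true ∧ ε j = true) → P ε = 0) ∧ ∀ i, ∑ ε, (if ε i then P ε else 0) = ∑ ε, (if ε i then 0 else P ε)) ↔ T.Colorable 2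

/-- item stmt-Parity-4346 · support · rank 9 · closed · moot by None · by planner
sources: Literature.Barriers.Parity.PrimePairParity, arXiv:1407.4897
[support] (card Crux 3, generalises PrimePairParity_holds from edge/path to every T) for every k, T,
natural shifts h : Fin k → ℕ and P ≥ 0 vanishing on patterns whose true-set contains a T-edge, the
weight ω(n) = P(i ↦ [λ(n + h_i) = −1]) satisfies: for every input class Inputs, Inputs ω → ¬
IsSieveTheoreticDeduction Inputs {n : some T-edge ij has n+h_i, n+h_j prime} — because λ = −1 at
primes makes ω vanish on the target set, so every weighted detection sum is 0 (proof =
PrimePairParity_holds verbatim with liouvilleR_prime). [difficulty: provable-now] -/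
@[route_item "route-Parity-TargetGraphParity"]
def GhostSchema : Prop :=
  ∀ (k : ℕ) (T : SimpleGraph (Fin k)) (h : Fin k → ℕ) (P : (Fin k → Bool) → ℝ), (∀ ε, 0 ≤ P ε) → (∀ ε, (∃ i j, T.Adj i j ∧ ε i = true ∧ ε j = true) → P ε = 0) → ∀ Inputs : (ℕ → ℝ) → Prop, Inputs (fun n => P (fun i => decide (((ArithmeticFunction.liouville (n + h i) : ℤ) : ℝ) = -1))) → ¬ (∀ ω : ℕ → ℝ, (∀ n, 0 ≤ ω n) → Inputs ω → ∃ x : ℕ, ∃ ν : ℕ → ℝ, (∀ n, 0 ≤ ν n) ∧ 0 < ∑ n ∈ Finset.Icc x (2 * x), ν n * Set.indicator {n : ℕ | ∃ i j, T.Adj i j ∧ (n + h i).Prime ∧ (n + h j).Prime} 1 n * ω n)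

/-- item stmt-Parity-4347 · support · rank 9 · closed · moot by None · by planner
sources: Mathlib SimpleGraph.two_colorable_iff_forall_loop_even, Literature.NumberTheory.Sieve.IsAdmissibleTuple
[support] if GraphDHL(C_{2r+3}) holds for every r (all odd cycles, injective admissible tuples),
then GraphDHL(T) holds for every non-2-colourable T on Fin k. Proof: a shortest odd closed walk of T
is an odd CYCLE, i.e. an injective homomorphism φ : cycleGraph (2r+3) → T; for an injective
admissible h, h ∘ φ is injective with admissible image (sub-tuples of admissible tuples are
admissible: tupleResidueCount is monotone), and a prime edge of the cycle maps to a prime edge of T.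
(Mathlib TODO 'IsBipartite ↔ no odd cycle' is the graph half.) [difficulty: M] -/
@[route_item "route-Parity-TargetGraphParity"]
def OddCycleReduction : Prop :=
  (∀ (r : ℕ) (h : Fin (2 * r + 3) → ℤ), Function.Injective h → Literature.NumberTheory.Sieve.IsAdmissibleTuple (Finset.univ.image h) → ∃ᶠ n : ℕ in Filter.atTop, ∃ i j : Fin (2 * r + 3), (SimpleGraph.cycleGraph (2 * r + 3)).Adj i j ∧ (0 < (n : ℤ) + h i ∧ ((n : ℤ) + h i).toNat.Prime) ∧ (0 < (n : ℤ) + h j ∧ ((n : ℤ) + h j).toNat.Prime)) → ∀ (k : ℕ) (T : SimpleGraph (Fin k)), ¬ T.Colorable 2 → ∀ h : Fin k → ℤ, Function.Injective h → Literature.NumberTheory.Sieve.IsAdmissibleTuple (Finset.univ.image h) → ∃ᶠ n : ℕ in Filter.atTop, ∃ i j : Fin k, T.Adj i j ∧ (0 < (n : ℤ) + h i ∧ ((n : ℤ) + h i).toNat.Prime) ∧ (0 < (n : ℤ) + h j ∧ ((n : ℤ) + h j).toNat.Prime)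

/-- item stmt-Parity-4348 · support · rank 9 · closed · moot by None · by planner
sources: Polymath8b2014, Literature.NumberTheory.Sieve.WeakDicksonHardyLittlewood, Literature.NumberTheory.Sieve.weakDHL_fifty_two
[support] (calibration glue) if every T-independent set has ≤ m vertices (α(T) ≤ m) then DHL[k, m+1]
(tree WeakDicksonHardyLittlewood k (m+1)) implies GraphDHL(T): m+1 primes among the k forms of an
injective tuple occupy a non-independent index set. Instances: K₅₀ unconditionally
(weakDHL_fifty_two), K₅ under EH (M₅ > 2), K₃ and every T on 51 vertices with α ≤ 2 under GEH
(Polymath 8b Thm 3.2 (xii),(xiii)); used in the Assembly for the triangle (cycleGraph 3 = ⊤, α = 1).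
[difficulty: provable-now] -/
@[route_item "route-Parity-TargetGraphParity"]
def PigeonholeDHL : Prop :=
  ∀ (k m : ℕ) (T : SimpleGraph (Fin k)), (∀ s : Finset (Fin k), (∀ i ∈ s, ∀ j ∈ s, ¬ T.Adj i j) → s.card ≤ m) → (∀ H : Finset ℤ, Literature.NumberTheory.Sieve.IsAdmissibleTuple H → H.card = k → ∃ᶠ n : ℕ in Filter.atTop, m + 1 ≤ (H.filter fun h => 0 < (n : ℤ) + h ∧ ((n : ℤ) + h).toNat.Prime).card) → ∀ h : Fin k → ℤ, Function.Injective h → Literature.NumberTheory.Sieve.IsAdmissibleTuple (Finset.univ.image h) → ∃ᶠ n : ℕ in Filter.atTop, ∃ i j : Fin k, T.Adj i j ∧ (0 < (n : ℤ) + h i ∧ ((n : ℤ) + h i).toNat.Prime) ∧ (0 < (n : ℤ) + h j ∧ ((n : ℤ) + h j).toNat.Prime)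

/-- item stmt-Parity-4349 · support · rank 9 · closed · moot by None · by planner
sources: arXiv:1910.13450, arXiv:1407.4897
[support] (addendum card ghost-lp-duality-hyperedges item 1, symmetric case) for the target "at
least m of the k forms prime" a sign ghost (P ≥ 0, positive mass, vanishing on patterns with ≥ m
trues, balanced marginals) exists IFF k + 2 ≤ 2m: ⇒ E|M| = k/2 ≤ m − 1; ⇐ M uniform of size k/2 (k
even) or sizes (k∓1)/2 mixed half-half (k odd). Makes Maynard's "cannot hope to prove k/2 of the
forms prime by a sieve" (arXiv:1910.13450 §6) exact: m = 2 is blocked iff k ≤ 2 (K₃ under GEH is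
sharp), m = 3 iff k ≤ 4 (so DHL[5,3] is ghost-free — the foreseen split of PentagonGEH).
[difficulty: provable-now] -/
@[route_item "route-Parity-TargetGraphParity"]
def ManyPrimesThreshold : Prop :=
  ∀ k m : ℕ, (∃ P : (Fin k → Bool) → ℝ, (∀ ε, 0 ≤ P ε) ∧ 0 < ∑ ε, P ε ∧ (∀ ε, m ≤ (Finset.univ.filter fun i => ε i = true).card → P ε = 0) ∧ ∀ i, ∑ ε, (if ε i then P ε else 0) = ∑ ε, (if ε i then 0 else P ε)) ↔ k + 2 ≤ 2 * m

/-- item stmt-Parity-4350 · assembly · rank 1 · closed · moot by None · by planner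
sources: folder Sketch.lean (assembly_sanity), Polymath8b2014
[assembly] PentagonGEH → HigherOddCyclesGEH → BipartiteCriterion → GhostSchema → OddCycleReduction →
PigeonholeDHL → ExactlyBipartite (bookkeeping; conclusion = the barrier-and-probe Target, declared). -/
@[route_item "route-Parity-TargetGraphParity"]
def Assembly : Prop :=
  PentagonGEH → HigherOddCyclesGEH → BipartiteCriterion → GhostSchema → OddCycleReduction → PigeonholeDHL → ExactlyBipartite

end Summit.Parity.GeneralizedHardyLittlewood.Theses.TargetGraphParity
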